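import Literature.AnabelianGeometry.AbsoluteAnabelian.AbsTopIII.GeometricCyclotomeSyncProofs
import Literature.AnabelianGeometry.AbsoluteAnabelian.FreeProcyclicStructure
import HarnessLib

/-!
# [AbsTopIII] Thm. 1.9 (b) in natural form HOLDS; Prop. 1.4 (ii) (`∃`-form) from its natural form

Mochizuki, *Topics in Absolute Anabelian Geometry III*, §1, Prop. 1.4 (ii) pp. 31–32, Thm. 1.9 (b) p. 37
(lit key `paper:url-5493eb38cbb7`).

The last input of `CurveModel.thm_1_9_b_natural_of_inertiaEquiv` / `CurveModel.prop_1_4_ii_sync_of`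
(`CcnSynchronizationBijective.lean`, `GeometricCyclotomeSyncProofs.lean`) was a topological isomorphism
`I_x ≅ Ẑ` for the inertia group of each cyclotome presentation.  abc-iut-L4-t6's
`FundamentalExtension.IsFreeProcyclic.exists_continuousAddEquiv_ulift_padicProd`
(`FreeProcyclicStructure.lean`: a free procyclic compact Hausdorff totally disconnected group is
`≃ₜ+ ULift (∏_p ℤ_p) = ZHatCoeff`) supplies it from `IsCyclotomePresentation.isFreeProcyclic`.  Hence,
all PROVED:

* `CurveModel.nonempty_inertiaEquivZHat` — the inertia group of a cyclotome presentation is `≃ₜ+ Ẑ`;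
* **`CurveModel.thm_1_9_b_natural_holds : M.Thm_1_9_b_natural`** — the named fact of
  `CcnSynchronizationModel.lean` is DISCHARGED for EVERY model `M`: THE natural, section-independent,
  `D_x`-equivariant synchronization `I_x → M_X = Hom(H²(Δ_X, Ẑ), Ẑ)` is bijective whenever the
  differential is (the bijectivity witness `hd` is a binder of the statement);
* `CurveModel.prop_1_4_ii_sync_of_transgression : Prop_1_4_i' → Prop_1_4_ii_transgression →
  Prop_1_4_ii_sync` — the `∃`-shaped Prop. 1.4 (ii) fact reduced to the two natural-form facts;
* `CurveModel.inertiaSyncEquivOfFacts` — the consumer endpoint `I_x ≃+ M_X` needing only the two facts.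

HONEST FRAMING: nothing here bears on [IUTchIII] Cor. 3.12; "d is an isomorphism"
(`Prop_1_4_ii_transgression`) and Prop. 1.4 (i) (`Prop_1_4_i'`) remain named facts.
-/

noncomputable section

open CategoryTheory

universe u

namespace Literature.AnabelianGeometry.AbsoluteAnabelian.AbsTopIII

namespace CurveModel

variable (M : CurveModel.{u})

/-- **The inertia group of a cyclotome presentation is topologically isomorphic to `Ẑ`** ("`I_x ≅ Ẑ(1)`"
with the action forgotten): from `IsCyclotomePresentation.isFreeProcyclic` by abc-iut-L4-t6's structure
theorem for free procyclic profinite groups. [cite: MochizukiAbsTopIII2015, Prop 1.4 (i) p.31] -/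
theorem nonempty_inertiaEquivZHat {Ux X : M.Curve} (h : M.IsCofiniteOpen Ux X) (x : (M.cusps Ux).Cusp)
    (hp : M.IsCyclotomePresentation h x) :
    Nonempty (Additive ((M.cusps Ux).Icusp x) ≃ₜ+ ZHatCoeff.{u}) := by
  haveI : CompactSpace ((M.cusps Ux).Icusp x) :=
    isCompact_iff_compactSpace.mp ((M.cusps Ux).isClosed_Icusp x).isCompact
  obtain ⟨e, -⟩ := hp.isFreeProcyclic.exists_continuousAddEquiv_ulift_padicProd
  exact ⟨e⟩

/-- **Thm. 1.9 (b) in natural form HOLDS for every model** ("One constructs the natural isomorphisms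
`I_z ⥲ μ_Ẑ(Π_U) := M_Z` [...] via the technique of Proposition 1.4, (ii)", p. 37, single-cusp
presentation): the named fact `Thm_1_9_b_natural` is DISCHARGED.
[cite: MochizukiAbsTopIII2015, Thm 1.9 (b) p.37] -/
theorem thm_1_9_b_natural_holds : M.Thm_1_9_b_natural :=
  M.thm_1_9_b_natural_of_inertiaEquiv fun _ _ h x hp => M.nonempty_inertiaEquivZHat h x hp

/-- **Prop. 1.4 (ii), `∃`-form, from its natural form**: `Prop_1_4_i'` (sections) and
`Prop_1_4_ii_transgression` ("d is an isomorphism") imply `Prop_1_4_ii_sync`.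
[cite: MochizukiAbsTopIII2015, Prop 1.4 (ii) p.32] -/
theorem prop_1_4_ii_sync_of_transgression (h14 : M.Prop_1_4_i') (hT : M.Prop_1_4_ii_transgression) :
    M.Prop_1_4_ii_sync :=
  M.prop_1_4_ii_sync_of h14 hT fun _ _ h x hp => M.nonempty_inertiaEquivZHat h x hp

/-- **Consumer endpoint: the natural synchronization `I_x ≃+ M_X`** of a cyclotome presentation from the
two named facts alone (Prop. 1.4 (i) for the section, Prop. 1.4 (ii) natural form for bijectivity of
the differential). [cite: MochizukiAbsTopIII2015, Thm 1.9 (b) p.37] -/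
def inertiaSyncEquivOfFacts (h14 : M.Prop_1_4_i') (hT : M.Prop_1_4_ii_transgression)
    {Ux X : M.Curve} (h : M.IsCofiniteOpen Ux X) (x : (M.cusps Ux).Cusp)
    (hp : M.IsCyclotomePresentation h x) :
    Additive ((M.cusps Ux).Icusp x) ≃+ geomCyclotomeDual (M.ext X) ZHatCoeff.{u} :=
  M.inertiaSyncEquiv h14 hT h x hp (M.nonempty_inertiaEquivZHat h x hp).some

/-- `D_x`-equivariance of the endpoint. [cite: MochizukiAbsTopIII2015, Thm 1.9 (b) p.37] -/
theorem inertiaSyncEquivOfFacts_decomp (h14 : M.Prop_1_4_i') (hT : M.Prop_1_4_ii_transgression)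
    {Ux X : M.Curve} (h : M.IsCofiniteOpen Ux X) (x : (M.cusps Ux).Cusp)
    (hp : M.IsCyclotomePresentation h x) {d : (M.ext Ux).arith} (hdx : d ∈ (M.cusps Ux).Dcusp x)
    (i : (M.cusps Ux).Icusp x) :
    M.inertiaSyncEquivOfFacts h14 hT h x hp
        (Additive.ofMul ⟨d * i * d⁻¹, (M.cusps Ux).conj_mem_Icusp x hdx i.2⟩) =
      geomCyclotomeDualMap (M.ext X) ZHatCoeff.{u} ((M.res h).arith d)
        (M.inertiaSyncEquivOfFacts h14 hT h x hp (Additive.ofMul i)) :=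
  M.inertiaSyncEquiv_decomp h14 hT h x hp _ hdx i

end CurveModel

end Literature.AnabelianGeometry.AbsoluteAnabelian.AbsTopIII
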